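import Mathlib.Algebra.MvPolynomial.Equiv
import Mathlib.Logic.Equiv.Fin.Rotate
import Literature.NumberTheory.Transcendental.KZCubicalCalculus
import Literature.ModelTheory.ExponentialFields.SemialgebraicInterior
import Literature.NumberTheory.Transcendental.SemialgebraicMaps

/-!
# `SectorToKernel`, line `effective-cube-surjection`: semialgebraic ⇒ algebraic over `ℚ[x]` (stub S2)

Helper file for the stub `stub_admissibleOfTame` of the crux `FurushoPentagon.SectorToKernel`
(stmt-KontsevichZagierPeriods-10813). A `ℚ`-semialgebraic function `f` on a set `s ⊆ ℝⁿ` is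
annihilated on `s` by ONE non-zero polynomial `P ∈ ℚ[x₁, …, xₙ][Y]`: `P(x, f x) = 0` for `x ∈ s`.
Proof: the graph `Γ ⊆ ℝⁿ⁺¹` of `f` over `s` is `ℚ`-semialgebraic with empty interior (a graph contains no
box), hence (sign-condition normal form, tree lemma `IsSemialgebraic.subset_interior_union`) lies in the
union of the zero sets of finitely many polynomials over `ℚ` none of which vanishes identically; their
product `Q ≠ 0` vanishes on `Γ`, and `P` is `Q` with the last variable singled out
(`MvPolynomial.finSuccEquiv` after the rotation `Fin.snoc x y = Fin.cons y x ∘ finRotate`).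

References: J. Bochnak, M. Coste, M.-F. Roy, *Real Algebraic Geometry* (1998), §2.1 and Prop. 2.8.2
(a semialgebraic set with empty interior lies in a proper algebraic subset); S. Basu, R. Pollack,
M.-F. Roy, *Algorithms in Real Algebraic Geometry* (2006), Def. 2.25, Prop. 2.27.
-/

noncomputable section

namespace Summit.KontsevichZagierPeriods.FurushoPentagon.SectorToKernel

open Set
open Literature.NumberTheory.Transcendental
open Literature.ModelTheory.ExponentialFields (IsSemialgebraic)

/-- A graph (over any set, of any function) along the last coordinate of `ℝⁿ⁺¹` has empty interior:
a ball around a point of the graph contains the point shifted along the last coordinate. [folklore] -/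
theorem admOfTame_interior_graph_eq_empty {n : ℕ} (s : Set (Fin n → ℝ)) (f : (Fin n → ℝ) → ℝ) :
    interior {z : Fin (n + 1) → ℝ | Fin.init z ∈ s ∧ z (Fin.last n) = f (Fin.init z)} = ∅ := by
  refine Set.eq_empty_iff_forall_notMem.2 fun z hz => ?_
  rw [mem_interior_iff_mem_nhds, Metric.mem_nhds_iff] at hz
  obtain ⟨ε, hε, hball⟩ := hz
  have hz0 := hball (Metric.mem_ball_self hε)
  have hz' : Function.update z (Fin.last n) (z (Fin.last n) + ε / 2) ∈ Metric.ball z ε := by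
    rw [Metric.mem_ball, dist_pi_lt_iff hε]
    intro b
    by_cases hb : b = Fin.last n
    · subst hb
      rw [Function.update_self, Real.dist_eq, add_sub_cancel_left, abs_of_pos (half_pos hε)]
      exact half_lt_self hε
    · rw [Function.update_of_ne hb, dist_self]
      exact hε
  have h1 := hball hz'
  simp only [mem_setOf_eq, Fin.init_update_last, Function.update_self] at h1 hz0
  linarith [h1.2, hz0.2]

/-- **A `ℚ`-semialgebraic function is annihilated on its domain by a non-zero polynomial over `ℚ` in
`n + 1` variables** (evaluated at `(x, f x)` realised as `Fin.snoc x (f x)`): its graph is a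
`ℚ`-semialgebraic set with empty interior, hence contained in the union of the zero sets of finitely many
polynomials over `ℚ` that do not vanish identically (`IsSemialgebraic.subset_interior_union`), whose
product works. [Bochnak–Coste–Roy 1998, Prop. 2.8.2; Basu–Pollack–Roy 2006, Prop. 2.27] -/
theorem admOfTame_exists_mvPolynomial_aeval_snoc_eq_zero {n : ℕ} {s : Set (Fin n → ℝ)}
    {f : (Fin n → ℝ) → ℝ} (hf : IsSemialgebraicFunOn ℚ s f) :
    ∃ Q : MvPolynomial (Fin (n + 1)) ℚ, Q ≠ 0 ∧
      ∀ x ∈ s, MvPolynomial.aeval (Fin.snoc x (f x) : Fin (n + 1) → ℝ) Q = 0 := by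
  classical
  have hG := isSemialgebraicFunOn_iff.1 hf
  obtain ⟨Q₀, hQ₀, hsub⟩ := hG.subset_interior_union
  rw [admOfTame_interior_graph_eq_empty, empty_union] at hsub
  refine ⟨∏ q ∈ Q₀, q, ?_, fun x hx => ?_⟩
  · rw [Finset.prod_ne_zero_iff]
    rintro q hq rfl
    obtain ⟨y, hy⟩ := hQ₀ 0 hq
    exact hy (map_zero _)
  · have hz : (Fin.snoc x (f x) : Fin (n + 1) → ℝ) ∈
        {z : Fin (n + 1) → ℝ | Fin.init z ∈ s ∧ z (Fin.last n) = f (Fin.init z)} := by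
      simp [hx]
    obtain ⟨q, hq, hq0⟩ := mem_iUnion₂.1 (hsub hz)
    rw [map_prod]
    exact Finset.prod_eq_zero hq hq0

/-- Evaluating `finSuccEquiv Q ∈ ℚ[x₁, …, xₙ][Y]` at `Y = y` over the point `x ∈ ℝⁿ` is evaluating
`Q` at `Fin.cons y x ∈ ℝⁿ⁺¹` (both sides are ring morphisms in `Q` agreeing on `C r` and the `X i`).
[folklore] -/
theorem admOfTame_eval₂_finSuccEquiv {n : ℕ} (x : Fin n → ℝ) (y : ℝ)
    (Q : MvPolynomial (Fin (n + 1)) ℚ) :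
    Polynomial.eval₂ (MvPolynomial.aeval x : MvPolynomial (Fin n) ℚ →ₐ[ℚ] ℝ).toRingHom y
        (MvPolynomial.finSuccEquiv ℚ n Q) =
      MvPolynomial.aeval (Fin.cons y x : Fin (n + 1) → ℝ) Q := by
  have key : (Polynomial.eval₂RingHom
        (MvPolynomial.aeval x : MvPolynomial (Fin n) ℚ →ₐ[ℚ] ℝ).toRingHom y).comp
        (MvPolynomial.finSuccEquiv ℚ n).toRingEquiv.toRingHom =
      (MvPolynomial.aeval (Fin.cons y x : Fin (n + 1) → ℝ)).toRingHom := by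
    refine MvPolynomial.ringHom_ext (fun r => ?_) (fun i => ?_)
    · simp [MvPolynomial.finSuccEquiv_apply]
    · refine Fin.cases ?_ (fun j => ?_) i
      · simp [MvPolynomial.finSuccEquiv_X_zero]
      · simp [MvPolynomial.finSuccEquiv_X_succ]
  exact RingHom.congr_fun key Q

/-- **Semialgebraic ⇒ algebraic over `ℚ[x]`.** A `ℚ`-semialgebraic function `f` on `s ⊆ ℝⁿ` satisfies
`P(x, f x) = 0` on `s` for one non-zero `P ∈ ℚ[x₁, …, xₙ][Y]` (the polynomial of
`admOfTame_exists_mvPolynomial_aeval_snoc_eq_zero` with its last variable singled out).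
[Bochnak–Coste–Roy 1998, Prop. 2.8.2; Basu–Pollack–Roy 2006, Prop. 2.27] -/
theorem admOfTame_exists_polynomial_of_isSemialgebraicFunOn {n : ℕ} {s : Set (Fin n → ℝ)}
    {f : (Fin n → ℝ) → ℝ} (hf : IsSemialgebraicFunOn ℚ s f) :
    ∃ P : Polynomial (MvPolynomial (Fin n) ℚ), P ≠ 0 ∧ ∀ x ∈ s,
      Polynomial.eval₂ (MvPolynomial.aeval x : MvPolynomial (Fin n) ℚ →ₐ[ℚ] ℝ).toRingHom (f x) P
        = 0 := by
  obtain ⟨Q, hQ, hroot⟩ := admOfTame_exists_mvPolynomial_aeval_snoc_eq_zero hf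
  refine ⟨MvPolynomial.finSuccEquiv ℚ n (MvPolynomial.rename (finRotate (n + 1)) Q), ?_,
    fun x hx => ?_⟩
  · exact (EmbeddingLike.map_ne_zero_iff).2
      ((MvPolynomial.rename_injective _ (finRotate (n + 1)).injective).ne hQ)
  · rw [admOfTame_eval₂_finSuccEquiv, MvPolynomial.aeval_rename, ← hroot x hx,
      Fin.snoc_eq_cons_rotate x (f x)]
    rfl

/-- **Registered form of `admOfTame_exists_polynomial_of_isSemialgebraicFunOn`** (all arguments
explicit): a `ℚ`-semialgebraic function is annihilated on its domain by a non-zero `P ∈ ℚ[x][Y]`.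
[Bochnak–Coste–Roy 1998, Prop. 2.8.2; Basu–Pollack–Roy 2006, Prop. 2.27] -/
theorem admOfTame_algebraicOfSemialgebraic :
    ∀ (n : ℕ) (s : Set (Fin n → ℝ)) (f : (Fin n → ℝ) → ℝ), Literature.NumberTheory.Transcendental.IsSemialgebraicFunOn ℚ s f → ∃ P : Polynomial (MvPolynomial (Fin n) ℚ), P ≠ 0 ∧ ∀ x ∈ s, Polynomial.eval₂ (MvPolynomial.aeval x : MvPolynomial (Fin n) ℚ →ₐ[ℚ] ℝ).toRingHom (f x) P = 0 :=
  fun _ _ _ hf => admOfTame_exists_polynomial_of_isSemialgebraicFunOn hf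

end Summit.KontsevichZagierPeriods.FurushoPentagon.SectorToKernel
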